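import Mathlib
import HarnessLib
import Literature.Combinatorics.Additive.Pollard
import Literature.Combinatorics.Additive.Kneser

/-!
# Grynkiewicz's extension of Pollard's theorem to abelian groups (`t`-representable sums)

Topic: `Literature/Combinatorics/Additive`.  Cell `mm-stpp` (D-0046 (i)): the printed theorem behind the
general-order form `U11-G` of the multi-representation packing rule for STPP families (candidate route
`MatrixMultiplication/AbelianSTPPCensusVP`).  NAMED FACTS (`def … : Prop`, never asserted) for the two printed
theorems, plus the weak forms the rule consumes, PROVED from them.  The proof of the theorems themselves
([Gry10] §2, an eight-page triple induction over Kneser's theorem, the Dyson e-transform and an additive-energy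
lemma) is not ported.

Notation.  For finite `A, B` in an abelian group, `r_{A,B}(x) = #{(a,b) ∈ A × B : a + b = x}` (the tree's
`Pollard.rep A B x`), `A +_i B = {x : r_{A,B}(x) ≥ i}` (the finset `(A + B).filter (i ≤ r_{A,B} ·)`),
`Σ_{i=1}^{t} |A +_i B| = Σ_{x ∈ A+B} min(t, r_{A,B}(x))` (cf. `Pollard.sum_min_rep_eq_sum_card_le`); the stabilizer of
a finset is the tree's `Finset.addStab` (`Literature.Combinatorics.Additive.Kneser`), an `H`-hole of `A′` is an
element of `(A′ + H) ∖ A′`.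

**Theorem 1.1** ([Gry10], verbatim): «Let `G` be an abelian group, let `t ≥ 1`, and let `A, B ⊆ G` be finite
and nonempty.  If `|A|, |B| ≥ t`, then either (6) `Σ_{i=1}^{t} |A +_i B| ≥ t|A| + t|B| − 2t² + 1`, or else
there exist `A′ ⊆ A` and `B′ ⊆ B` with (7) `l := |A ∖ A′| + |B ∖ B′| ≤ t − 1`, (8) `A′ +_t B′ = A′ + B′ = A +_t B`,
and (9) `Σ_{i=1}^{t} |A +_i B| ≥ t|A| + t|B| − (t − l)(|H| − ρ) − tl ≥ t|A| + t|B| − t|H|`, where `H` is the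
(nontrivial) stabilizer of `A +_t B` and `ρ = |A′ + H| − |A′| + |B′ + H| − |B′|.»

**Theorem 1.2** ([Gry10], `t = 2`, sharp constant): «Let `G` be an abelian group, and let `A, B ⊆ G` be finite
and nonempty.  If `|A|, |B| ≥ 2`, then either (10) `|A +_1 B| + |A +_2 B| ≥ 2|A| + 2|B| − 4`, or else there exist
`A′ ⊆ A` and `B′ ⊆ B` with (11) `l := |A ∖ A′| + |B ∖ B′| ≤ 1`, (12) `A′ +_2 B′ = A′ + B′ = A +_2 B`, and (13)
`|A +_1 B| + |A +_2 B| ≥ 2|A| + 2|B| − (2 − l)(|H| − ρ) − 2l ≥ 2|A| + 2|B| − 2|H|`, where `H` is the (nontrivial)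
stabilizer of `A +_2 B` and `ρ = |A′ + H| − |A′| + |B′ + H| − |B′|.»

* `grynkiewicz2010_thm_1_1`, `grynkiewicz2010_thm_1_2` — the printed statements ((9)/(13) over `ℤ`);
* `grynkiewicz2010_thm_1_1_weak`, `grynkiewicz2010_thm_1_2_weak` — PROVED corollaries: (6) [resp. (10)] or
  `A′, B′` with (7) [resp. (11)] and every element of `A′ + B′` `t`-represented in `A + B` (from (8)/(12)).

The prime-order case without alternative is Pollard's theorem (tree: `Literature.Combinatorics.Additive.pollard`).

## References
* D. J. Grynkiewicz, *On extending Pollard's theorem for t-representable sums*, Israel J. Math. 177 (2010)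
  413–439, doi:10.1007/s11856-010-0053-6 (= arXiv:0803.2601), Theorem 1.1 and Theorem 1.2
  [cite: Grynkiewicz2010, Thm 1.1] [cite: Grynkiewicz2010, Thm 1.2].
* J. M. Pollard, *A generalisation of the theorem of Cauchy and Davenport*, J. London Math. Soc. (2) 8
  (1974) 460–462 [cite: Pollard1974, Thm 1].
-/

namespace Literature.Combinatorics.Additive

open Finset
open scoped Pointwise

/-- **Grynkiewicz 2010, Theorem 1.1** (as printed).  `G` abelian, `t ≥ 1`, `A, B ⊆ G` finite nonempty with
`|A|, |B| ≥ t`: either (6) `Σ_{x ∈ A+B} min(t, r_{A,B}(x)) ≥ t|A| + t|B| − 2t² + 1`, or there are `A′ ⊆ A`,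
`B′ ⊆ B` with (7) `l = |A ∖ A′| + |B ∖ B′| ≤ t − 1`, (8) `A′ +_t B′ = A′ + B′ = A +_t B`, `H = ` the stabilizer of
`A +_t B` nontrivial, and (9) `Σ ≥ t|A| + t|B| − (t − l)(|H| − ρ) − tl ≥ t|A| + t|B| − t|H|` with
`ρ = |A′ + H| − |A′| + |B′ + H| − |B′|` ((9) stated over `ℤ`). [cite: Grynkiewicz2010, Thm 1.1] -/
def grynkiewicz2010_thm_1_1 : Prop :=
  ∀ (G : Type) [AddCommGroup G] [DecidableEq G] (A B : Finset G) (t : ℕ), 1 ≤ t →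
    A.Nonempty → B.Nonempty → t ≤ A.card → t ≤ B.card →
    t * A.card + t * B.card + 1 ≤ (∑ x ∈ A + B, min t (Pollard.rep A B x)) + 2 * t ^ 2 ∨
    ∃ A' ⊆ A, ∃ B' ⊆ B,
      let S : Finset G := (A + B).filter (fun x => t ≤ Pollard.rep A B x)
      let H : Finset G := S.addStab
      let l : ℕ := (A \ A').card + (B \ B').card
      let ρ : ℕ := ((A' + H).card - A'.card) + ((B' + H).card - B'.card)
      l + 1 ≤ t ∧
      (A' + B').filter (fun x => t ≤ Pollard.rep A' B' x) = A' + B' ∧ A' + B' = S ∧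
      1 < H.card ∧
      (t : ℤ) * A.card + t * B.card - (t - l) * ((H.card : ℤ) - ρ) - t * l ≤
        ((∑ x ∈ A + B, min t (Pollard.rep A B x) : ℕ) : ℤ) ∧
      (t : ℤ) * A.card + t * B.card - t * H.card ≤
        (t : ℤ) * A.card + t * B.card - (t - l) * ((H.card : ℤ) - ρ) - t * l

/-- **Grynkiewicz 2010, Theorem 1.2** (as printed; `t = 2`, sharp constant).  `G` abelian, `A, B ⊆ G` finite
nonempty with `|A|, |B| ≥ 2`: either (10) `|A +_1 B| + |A +_2 B| ≥ 2|A| + 2|B| − 4`, or there are `A′ ⊆ A`,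
`B′ ⊆ B` with (11) `l ≤ 1`, (12) `A′ +_2 B′ = A′ + B′ = A +_2 B`, `H = ` the stabilizer of `A +_2 B` nontrivial,
and (13) `|A +_1 B| + |A +_2 B| ≥ 2|A| + 2|B| − (2 − l)(|H| − ρ) − 2l ≥ 2|A| + 2|B| − 2|H|` ((13) over `ℤ`).
[cite: Grynkiewicz2010, Thm 1.2] -/
def grynkiewicz2010_thm_1_2 : Prop :=
  ∀ (G : Type) [AddCommGroup G] [DecidableEq G] (A B : Finset G), A.Nonempty → B.Nonempty →
    2 ≤ A.card → 2 ≤ B.card →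
    2 * A.card + 2 * B.card ≤ (∑ x ∈ A + B, min 2 (Pollard.rep A B x)) + 4 ∨
    ∃ A' ⊆ A, ∃ B' ⊆ B,
      let S : Finset G := (A + B).filter (fun x => 2 ≤ Pollard.rep A B x)
      let H : Finset G := S.addStab
      let l : ℕ := (A \ A').card + (B \ B').card
      let ρ : ℕ := ((A' + H).card - A'.card) + ((B' + H).card - B'.card)
      l ≤ 1 ∧
      (A' + B').filter (fun x => 2 ≤ Pollard.rep A' B' x) = A' + B' ∧ A' + B' = S ∧
      1 < H.card ∧
      (2 : ℤ) * A.card + 2 * B.card - (2 - l) * ((H.card : ℤ) - ρ) - 2 * l ≤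
        ((∑ x ∈ A + B, min 2 (Pollard.rep A B x) : ℕ) : ℤ) ∧
      (2 : ℤ) * A.card + 2 * B.card - 2 * H.card ≤
        (2 : ℤ) * A.card + 2 * B.card - (2 - l) * ((H.card : ℤ) - ρ) - 2 * l

/-- **Theorem 1.1, weak form** (the alternative the cell's rule U11-G excludes): either (6), or `A′ ⊆ A`,
`B′ ⊆ B` with (7) and every element of `A′ + B′` having at least `t` representations in `A + B` — from (8),
since `A′ + B′ = A +_t B`.  PROVED from the printed statement. [cite: Grynkiewicz2010, Thm 1.1] -/
theorem grynkiewicz2010_thm_1_1_weak (h : grynkiewicz2010_thm_1_1) :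
    ∀ (G : Type) [AddCommGroup G] [DecidableEq G] (A B : Finset G) (t : ℕ), 1 ≤ t →
      t ≤ A.card → t ≤ B.card →
      t * A.card + t * B.card + 1 ≤ (∑ x ∈ A + B, min t (Pollard.rep A B x)) + 2 * t ^ 2 ∨
      ∃ A' ⊆ A, ∃ B' ⊆ B, (A \ A').card + (B \ B').card + 1 ≤ t ∧
        ∀ x ∈ A' + B', t ≤ Pollard.rep A B x := by
  intro G _ _ A B t ht htA htB
  have hA : A.Nonempty := card_pos.1 (by omega)
  have hB : B.Nonempty := card_pos.1 (by omega)
  rcases h G A B t ht hA hB htA htB with h6 | ⟨A', hA', B', hB', h7, -, h8, -⟩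
  · exact Or.inl h6
  · refine Or.inr ⟨A', hA', B', hB', h7, fun x hx => ?_⟩
    rw [h8, mem_filter] at hx
    exact hx.2

/-- **Theorem 1.2, weak form**: either (10), or `A′ ⊆ A`, `B′ ⊆ B` with (11) and every element of `A′ + B′`
having at least `2` representations in `A + B` (from (12)).  PROVED from the printed statement.
[cite: Grynkiewicz2010, Thm 1.2] -/
theorem grynkiewicz2010_thm_1_2_weak (h : grynkiewicz2010_thm_1_2) :
    ∀ (G : Type) [AddCommGroup G] [DecidableEq G] (A B : Finset G), 2 ≤ A.card → 2 ≤ B.card →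
      2 * A.card + 2 * B.card ≤ (∑ x ∈ A + B, min 2 (Pollard.rep A B x)) + 4 ∨
      ∃ A' ⊆ A, ∃ B' ⊆ B, (A \ A').card + (B \ B').card ≤ 1 ∧
        ∀ x ∈ A' + B', 2 ≤ Pollard.rep A B x := by
  intro G _ _ A B htA htB
  have hA : A.Nonempty := card_pos.1 (by omega)
  have hB : B.Nonempty := card_pos.1 (by omega)
  rcases h G A B hA hB htA htB with h10 | ⟨A', hA', B', hB', h11, -, h12, -⟩
  · exact Or.inl h10
  · refine Or.inr ⟨A', hA', B', hB', h11, fun x hx => ?_⟩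
    rw [h12, mem_filter] at hx
    exact hx.2

end Literature.Combinatorics.Additive
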